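import Mathlib.Analysis.ODE.Gronwall
import Literature.Analysis.FunctionSpaces.BesselKPolya
import Literature.NumberTheory.Automorphic.FuchsianEisensteinConstantTerm
import HarnessLib

/-!
# The non-zero Fourier modes of a Maass form: Whittaker functions and Iwaniec's Theorem 3.1
(Iwaniec, *Spectral Methods of Automorphic Forms*, GSM 53, §1.7 (1.25)–(1.27), Theorem 3.1
(3.2)–(3.4); PDF pp. 17, 40–41)

Sibling of `MaassFormZeroMode.lean` (the zero-th mode, real `s`) and `FuchsianEisensteinConstantTerm.lean`
(the zero-th mode, complex `s`, at a cusp of a general group): the NON-ZERO Fourier modes of a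
`1`-periodic eigenfunction of the hyperbolic Laplacian, i.e. the Whittaker functions of Iwaniec's
Theorem 3.1, for a GENERAL discrete `Γ ≤ SL₂(ℝ)` at a cusp of width one. This is the first input of
every Fourier-coefficient formula of the spectral theory (the coefficients `ρ_𝔞j(n)` of Maass cusp
forms, `φ_𝔞(n, s)` of Eisenstein series and the unfolding of Poincaré series against them, Chapters
3, 8, 9 of the book; ultimately the Kuznetsov formula for `Γ₀(q)`). Everything is PROVED; nothing is
vendored; no fact is introduced.

1. (§1) **Sharp decay of Pólya's function** `G_n(x, w) = ∫ cosh(t)^n e^{-x cosh t} e^{iwt} dt`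
   (`G_0(x, w) = 2K_{iw}(x)`, `PolyaBesselKernel.lean`): `‖G_n(x, w)‖ ≤ 2√(2π/x) e^{(n+‖w‖)²/(2x)} e^{-x}`
   (`norm_polyaG_le_gaussian`; `cosh t ≥ 1 + t²/2` and a shifted Gaussian integral) — the true order
   `e^{-x}/√x`, which the tree's `norm_polyaG_le` (`≪ e^{-x}`) misses and which Theorem 3.1 needs for
   `|n| = 1`.
2. (§2) **The Whittaker function** `whittakerW s y = 2√y K_{s-1/2}(2πy)` ((1.26) without `e(x)`) and
   the Bessel mode `besselMode κ w y = √y G_0(κy, w)` with its derivative `besselMode₁`: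
   `whittakerW s (r y) = √r · besselMode (2πr) (-i(s-1/2)) y`; **the mode solves (1.25) rescaled**,
   `k' = k₁`, `k₁' = (κ² - (w² + 1/4)/y²) k` (`hasDerivAt_besselMode`, `hasDerivAt_besselMode₁`, from
   Pólya's modified Bessel equation `polyaG_ode`), with `(-i(s-1/2))² + 1/4 = s(1-s)`; the decay
   `‖k(y)‖, ‖k₁(y)‖ ≤ C e^{-κy}` on `[1, ∞)` (`norm_besselMode_le`, `norm_besselMode₁_le`) and
   non-vanishing (`exists_besselMode_ne_zero`, from Pólya's `exists_polyaG_zero_ne_zero`).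
3. (§3) **Linear equations `u'' = q u` on `(0, ∞)`**: uniqueness from Cauchy data (`linearODE_eq_zero`,
   Grönwall through Mathlib's `ODE_solution_unique_of_mem_Ioo` for the system `(u, u')`), constancy of
   the Wronskian, `‖u'(y)‖ ≤ ‖u(y+1)‖ + ‖u(y)‖ + sup_{[y,y+1]} ‖q u‖` (Taylor), and **the growth
   dichotomy** `exists_eq_const_mul_of_growth`: for `q = κ² - μ/y²`, a solution `b = o(e^{κy})` is a
   constant multiple of any non-trivial solution `k` with `k, k' = O(e^{-κy})` — the bounds force the
   Wronskian `k b' - k' b` to vanish ("this condition rules out the second solution", p. 20).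
4. (§4) **The twisted modes** `fourierMode F n y = ∫₀¹ F(x+iy) e(-nx) dx` of a `C²` function on the
   upper half-plane: differentiation under `∫₀¹` with a continuous weight, two integrations by parts
   (`∫₀¹ F_xx e(-nx) = -4π²n² a_n`, boundary terms cancel by periodicity), and, for `y²ΔF + μF = 0`,
   **`a_n'' = ((2π|n|)² - μ/y²) a_n`** (`hasDerivAt_fourierMode_deriv_eq`).
5. (§5) **Theorem 3.1, non-zero modes** (`fourierMode_eq_const_mul_whittakerW`): `F` `C²`, `1`-periodic,
   `y²ΔF + s(1-s)F = 0`, `F(x+iy) = o(e^{2πy})` uniformly in `x ∈ [0,1]` ((3.3)) ⇒ for `n ≠ 0`,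
   `∫₀¹ F(x+iy) e(-nx) dx = c_n · whittakerW s (|n| y)` for all `y > 0`, `c_n` unique
   (`whittaker_coeff_unique`) — (3.4) coefficientwise.
6. (§6) **At a cusp `𝔞 = σ∞` of width one** (`T₁ ∈ σ⁻¹Γσ`): `Fuchsian.cuspFourierModeAt σ v n w =
   ∫₀¹ v(σ(w + ξ)) e(-nξ) dξ` (companion of `Fuchsian.cuspMeanAt`, its `n = 0` case), Theorem 3.1 for
   a `Γ`-automorphic `C²` eigenfunction with the growth (3.3) in the cusp
   (`Fuchsian.cuspFourierModeAt_eq_const_mul_whittakerW`), the coefficient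
   `Fuchsian.cuspFourierCoeff σ v s n = ρ_𝔞(n)` (the constant of Theorem 3.1, `0` if none) and the
   expansion identity `∫₀¹ v(σ(x+iy)) e(-nx) dx = ρ_𝔞(n) · 2√(|n|y) K_{s-1/2}(2π|n|y)`
   (`Fuchsian.cuspFourierModeAt_eq_cuspFourierCoeff_mul_whittakerW`).

Not here: the pointwise convergence of the Fourier series (3.4) itself, the bound
`f̂_𝔞(n) ≪ e^{ε|n|}` and (3.7), Theorem 3.2 (3.8), the second solution `V_s` ((1.36)).

## References
* [Iwaniec2002] H. Iwaniec, *Spectral Methods of Automorphic Forms*, 2nd ed., GSM 53, AMS 2002,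
  §1.7 (1.25)–(1.27), PDF pp. 17, 20; §3.1 (3.2)–(3.4) & Theorem 3.1, PDF pp. 40–41
  (held copy `book:iwaniec2002-spectral-methods-automorphic-forms`).
* [Polya1926] G. Pólya, Acta Math. 48 (1926) 305–317 (the function `𝔊`), as proved in
  `Literature/Analysis/Complex/PolyaBesselKernel.lean`; [BatemanGrosswald1964] §1 (2) for `K_ν`
  (`Literature/Analysis/FunctionSpaces/BesselK.lean`, `BesselKPolya.lean`).

Mathlib: `ODE_solution_unique_of_mem_Ioo`, `LipschitzWith.prodMk`, `lipschitzWith_smul`,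
`HasDerivAt.prodMk`, `integral_gaussian`, `integral_sub_right_eq_self`, `integrable_exp_neg_mul_sq`,
`intervalIntegral.integral_deriv_mul_eq_sub`, `intervalIntegral.hasDerivAt_integral_of_dominated_loc_of_deriv_le`,
`intervalIntegral.norm_integral_le_of_norm_le_const`, `Complex.exp_int_mul_two_pi_mul_I`, `Real.hasDerivAt_sqrt`.
Literature: `polyaG`, `polyaG_ode`, `hasDerivAt_polyaG`, `exists_polyaG_zero_ne_zero`, `polyaKernel_mul_exp_le`,
`norm_cexp_I_mul_mul_le`, `DeBruijn1950.one_add_sq_div_two_le_cosh` (`PolyaBesselKernel`, `DeBruijnUniversalFactors*`);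
`besselK`, `besselK_eq_half_polyaG` (`BesselK`, `BesselKPolya`); `hasDerivAt_comp_horizontal/vertical`,
`hasFDerivAt_fderiv_apply`, `fderiv_fderiv_apply`, `continuous_comp_horizontal`, `fderiv_periodic`, `im_pos_of_pt`,
`differentiableAt(_fderiv)_of_C2`, `continuous_fderiv_fderiv_horizontal`, `exists_const_of_hasDerivAt_zero_Ioi`
(`MaassFormZeroMode`); `periodic_of_upperRightHom_mem`, `eigen_ofComplex_complex` (`FuchsianEisensteinConstantTerm`);
`Fuchsian.cuspMeanAt` (`FuchsianCuspidalSubspace`); `IsC2.comp_smul`, `hypLaplacian_comp_smul`, `Fuchsian.mem_conj_inv_iff`,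
`toGL_smul_eq`. Tree search before writing (`lean search 'whittaker|besselK.*deriv|fourierMode|cuspCoeff'`,
`grep besselK Literature/NumberTheory/Automorphic`): no Whittaker functions / non-zero modes anywhere
(only `ModularEisensteinFourier` uses `besselK`, through the Chowla–Selberg series `bgH`).
-/

noncomputable section

namespace Literature.NumberTheory.Automorphic

open Filter _root_.MeasureTheory Real intervalIntegral Set Complex
open scoped _root_.Topology
open Literature.Analysis.Complex Literature.Analysis.Complex.Polya1926 Literature.Analysis.FunctionSpaces

/-! ## 1. Sharp exponential decay of `G_n(x, w)`: the factor `x^{-1/2}` -/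

section PolyaDecay

/-- The shifted Gaussian integral `∫ e^{-(x/2)t² + ct} dt = e^{c²/(2x)} √(2π/x)` (`x > 0`). [folklore] -/
theorem integral_exp_neg_half_mul_sq_add (x c : ℝ) (hx : 0 < x) :
    ∫ t : ℝ, Real.exp (-(x / 2) * t ^ 2 + c * t) =
      Real.exp (c ^ 2 / (2 * x)) * Real.sqrt (2 * π / x) := by
  have h : (fun t : ℝ => Real.exp (-(x / 2) * t ^ 2 + c * t)) =
      fun t => Real.exp (c ^ 2 / (2 * x)) * Real.exp (-(x / 2) * (t - c / x) ^ 2) := by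
    funext t
    rw [← Real.exp_add]
    congr 1
    field_simp
    ring
  rw [h, MeasureTheory.integral_const_mul,
    integral_sub_right_eq_self (fun t => Real.exp (-(x / 2) * t ^ 2)) (c / x), integral_gaussian]
  congr 2
  rw [div_div_eq_mul_div]
  ring

/-- Integrability of `e^{-(x/2)t² + ct}`. [folklore] -/
theorem integrable_exp_neg_half_mul_sq_add (x c : ℝ) (hx : 0 < x) :
    Integrable fun t : ℝ => Real.exp (-(x / 2) * t ^ 2 + c * t) := by
  have h : (fun t : ℝ => Real.exp (-(x / 2) * t ^ 2 + c * t)) =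
      fun t => Real.exp (c ^ 2 / (2 * x)) * Real.exp (-(x / 2) * (t - c / x) ^ 2) := by
    funext t
    rw [← Real.exp_add]
    congr 1
    field_simp
    ring
  rw [h]
  exact ((integrable_exp_neg_mul_sq (half_pos hx)).comp_sub_right (c / x)).const_mul _

/-- `∫ e^{-(x/2)t²} e^{c|t|} dt ≤ 2 e^{c²/(2x)} √(2π/x)` (`e^{c|t|} ≤ e^{ct} + e^{-ct}`). [folklore] -/
theorem integral_exp_neg_half_mul_sq_mul_exp_abs_le (x c : ℝ) (hx : 0 < x) :
    ∫ t : ℝ, Real.exp (-(x / 2) * t ^ 2) * Real.exp (c * |t|) ≤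
      2 * (Real.exp (c ^ 2 / (2 * x)) * Real.sqrt (2 * π / x)) := by
  have hle : ∀ t : ℝ, Real.exp (-(x / 2) * t ^ 2) * Real.exp (c * |t|) ≤
      Real.exp (-(x / 2) * t ^ 2 + c * t) + Real.exp (-(x / 2) * t ^ 2 + -c * t) := by
    intro t
    rw [Real.exp_add, Real.exp_add, ← mul_add]
    gcongr
    rcases le_total 0 t with ht | ht
    · rw [abs_of_nonneg ht]
      linarith [Real.exp_pos (-c * t)]
    · rw [abs_of_nonpos ht, show c * -t = -c * t by ring]
      linarith [Real.exp_pos (c * t)]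
  have hi1 := integrable_exp_neg_half_mul_sq_add x c hx
  have hi2 := integrable_exp_neg_half_mul_sq_add x (-c) hx
  have hi12 : Integrable fun t : ℝ =>
      Real.exp (-(x / 2) * t ^ 2 + c * t) + Real.exp (-(x / 2) * t ^ 2 + -c * t) := hi1.add hi2
  calc ∫ t : ℝ, Real.exp (-(x / 2) * t ^ 2) * Real.exp (c * |t|)
      ≤ ∫ t : ℝ, (Real.exp (-(x / 2) * t ^ 2 + c * t) + Real.exp (-(x / 2) * t ^ 2 + -c * t)) := by
        refine integral_mono_of_nonneg (Eventually.of_forall fun t => by positivity) hi12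
          (Eventually.of_forall hle)
    _ = 2 * (Real.exp (c ^ 2 / (2 * x)) * Real.sqrt (2 * π / x)) := by
        rw [integral_add hi1 hi2, integral_exp_neg_half_mul_sq_add x c hx,
          integral_exp_neg_half_mul_sq_add x (-c) hx, neg_sq]
        ring

/-- **Sharp decay of Pólya's function**: `‖G_n(x, w)‖ ≤ 2√(2π/x) e^{(n+‖w‖)²/(2x)} e^{-x}` for
`x > 0` — the true order `e^{-x}/√x` of `2K_{iw}(x) = G_0(x, w)` (`cosh t ≥ 1 + t²/2` turns the
kernel into a Gaussian). [folklore] -/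
theorem norm_polyaG_le_gaussian {x : ℝ} (hx : 0 < x) (n : ℕ) (w : ℂ) :
    ‖polyaG n x w‖ ≤ 2 * (Real.exp (((n : ℝ) + ‖w‖) ^ 2 / (2 * x)) * Real.sqrt (2 * π / x)) *
      Real.exp (-x) := by
  set c : ℝ := (n : ℝ) + ‖w‖ with hc
  have hpt : ∀ t : ℝ, ‖(polyaKernel n x t : ℂ) * Complex.exp (I * w * t)‖ ≤
      Real.exp (-x) * (Real.exp (-(x / 2) * t ^ 2) * Real.exp (c * |t|)) := by
    intro t
    rw [norm_mul, norm_polyaKernel]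
    calc polyaKernel n x t * ‖Complex.exp (I * w * t)‖
        ≤ polyaKernel n x t * Real.exp (‖w‖ * |t|) := by
          gcongr
          · exact polyaKernel_nonneg n x t
          · exact norm_cexp_I_mul_mul_le w t
      _ ≤ polyaKernel 0 x t * Real.exp ((n + ‖w‖) * |t|) := polyaKernel_mul_exp_le n x ‖w‖ t
      _ ≤ (Real.exp (-x) * Real.exp (-(x / 2) * t ^ 2)) * Real.exp (c * |t|) := by
          gcongr
          rw [polyaKernel_zero, ← Real.exp_add]
          apply Real.exp_le_exp.2
          have h := DeBruijn1950.one_add_sq_div_two_le_cosh t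
          nlinarith
      _ = _ := by ring
  have hint : Integrable fun t : ℝ => Real.exp (-x) * (Real.exp (-(x / 2) * t ^ 2) * Real.exp (c * |t|)) := by
    refine Integrable.const_mul ?_ _
    have hi1 := integrable_exp_neg_half_mul_sq_add x c hx
    have hi2 := integrable_exp_neg_half_mul_sq_add x (-c) hx
    have hi12 : Integrable fun t : ℝ =>
        Real.exp (-(x / 2) * t ^ 2 + c * t) + Real.exp (-(x / 2) * t ^ 2 + -c * t) := hi1.add hi2
    refine hi12.mono' (by fun_prop) (Eventually.of_forall fun t => ?_)
    rw [Real.norm_eq_abs, abs_of_nonneg (by positivity)]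
    rw [Real.exp_add, Real.exp_add, ← mul_add]
    gcongr
    rcases le_total 0 t with ht | ht
    · rw [abs_of_nonneg ht]
      linarith [Real.exp_pos (-c * t)]
    · rw [abs_of_nonpos ht, show c * -t = -c * t by ring]
      linarith [Real.exp_pos (c * t)]
  calc ‖polyaG n x w‖ = ‖∫ t : ℝ, (polyaKernel n x t : ℂ) * Complex.exp (I * w * t)‖ := by rw [polyaG_eq]
    _ ≤ ∫ t : ℝ, ‖(polyaKernel n x t : ℂ) * Complex.exp (I * w * t)‖ := norm_integral_le_integral_norm _
    _ ≤ ∫ t : ℝ, Real.exp (-x) * (Real.exp (-(x / 2) * t ^ 2) * Real.exp (c * |t|)) :=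
        integral_mono_of_nonneg (Eventually.of_forall fun t => norm_nonneg _) hint (Eventually.of_forall hpt)
    _ = Real.exp (-x) * ∫ t : ℝ, Real.exp (-(x / 2) * t ^ 2) * Real.exp (c * |t|) := integral_const_mul _ _
    _ ≤ Real.exp (-x) * (2 * (Real.exp (c ^ 2 / (2 * x)) * Real.sqrt (2 * π / x))) := by
        gcongr
        exact integral_exp_neg_half_mul_sq_mul_exp_abs_le x c hx
    _ = _ := by ring

/-- The decay in the form used below: for `x ≥ a > 0`,
`‖G_n(x, w)‖ ≤ (2√(2π) e^{(n+‖w‖)²/(2a)}) · e^{-x}/√x`. [folklore] -/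
theorem norm_polyaG_le_exp_div_sqrt {a x : ℝ} (ha : 0 < a) (hax : a ≤ x) (n : ℕ) (w : ℂ) :
    ‖polyaG n x w‖ ≤ (2 * Real.sqrt (2 * π) * Real.exp (((n : ℝ) + ‖w‖) ^ 2 / (2 * a))) *
      (Real.exp (-x) / Real.sqrt x) := by
  have hx : 0 < x := lt_of_lt_of_le ha hax
  refine (norm_polyaG_le_gaussian hx n w).trans ?_
  have h1 : Real.exp (((n : ℝ) + ‖w‖) ^ 2 / (2 * x)) ≤ Real.exp (((n : ℝ) + ‖w‖) ^ 2 / (2 * a)) := by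
    apply Real.exp_le_exp.2
    apply div_le_div_of_nonneg_left (by positivity) (by positivity)
    linarith
  have h2 : Real.sqrt (2 * π / x) = Real.sqrt (2 * π) / Real.sqrt x := by
    rw [Real.sqrt_div (by positivity)]
  rw [h2]
  have h3 : 0 ≤ Real.exp (-x) / Real.sqrt x := by positivity
  calc 2 * (Real.exp (((n : ℝ) + ‖w‖) ^ 2 / (2 * x)) * (Real.sqrt (2 * π) / Real.sqrt x)) * Real.exp (-x)
      = 2 * Real.sqrt (2 * π) * Real.exp (((n : ℝ) + ‖w‖) ^ 2 / (2 * x)) * (Real.exp (-x) / Real.sqrt x) := by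
        ring
    _ ≤ 2 * Real.sqrt (2 * π) * Real.exp (((n : ℝ) + ‖w‖) ^ 2 / (2 * a)) * (Real.exp (-x) / Real.sqrt x) := by
        gcongr

end PolyaDecay

/-! ## 2. The Whittaker function `W_s(iy) = 2√y K_{s-1/2}(2πy)` and the Bessel mode `√y G₀(κy, w)` -/

section Whittaker

/-- **The Whittaker function** (radial part): `whittakerW s y = 2 √y K_{s-1/2}(2π y)`, so that
Iwaniec's `W_s(z) = 2 y^{1/2} K_{s-1/2}(2πy) e(x)` ((1.26)) is `whittakerW s y · e(x)` and, with the
symmetry `W_s(z̄) = W_s(z)` ((1.27)), `W_s(nz) = whittakerW s (|n| y) · e(nx)` for `n ≠ 0`.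
[cite: Iwaniec2002, (1.26)–(1.27), PDF p. 17] -/
def whittakerW (s : ℂ) (y : ℝ) : ℂ :=
  2 * (Real.sqrt y : ℂ) * besselK (s - 1 / 2) ((2 * π * y : ℝ) : ℂ)

/-- **The Bessel mode** `k(y) = √y · G₀(κy, w)` (`= 2√y K_{iw}(κy)`): the decaying solution of
`y² k'' = (κ² y² - (w² + 1/4)) k` ((1.25) rescaled). [cite: Iwaniec2002, (1.25)–(1.26), PDF p. 17] -/
def besselMode (κ : ℝ) (w : ℂ) (y : ℝ) : ℂ :=
  (Real.sqrt y : ℂ) * polyaG 0 (κ * y) w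

/-- The derivative `k'(y) = G₀(κy, w)/(2√y) - κ √y G₁(κy, w)` of the Bessel mode. [folklore] -/
def besselMode₁ (κ : ℝ) (w : ℂ) (y : ℝ) : ℂ :=
  polyaG 0 (κ * y) w / (2 * (Real.sqrt y : ℂ)) - κ * (Real.sqrt y : ℂ) * polyaG 1 (κ * y) w

/-- `W_s` through the Bessel mode: `whittakerW s (r y) = √r · besselMode (2πr) (-i(s - 1/2)) y`
(`r, y > 0`). [cite: Iwaniec2002, (1.26), PDF p. 17] -/
theorem whittakerW_eq_besselMode (s : ℂ) {r y : ℝ} (hr : 0 < r) (hy : 0 < y) :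
    whittakerW s (r * y) = (Real.sqrt r : ℂ) * besselMode (2 * π * r) (-I * (s - 1 / 2)) y := by
  rw [whittakerW, besselMode, besselK_eq_half_polyaG (by positivity), Real.sqrt_mul hr.le,
    show 2 * π * (r * y) = 2 * π * r * y by ring]
  push_cast
  ring

/-- `(-i(s - 1/2))² + 1/4 = s(1 - s)`: the eigenvalue in terms of the order. [folklore] -/
theorem neg_I_mul_sq_add_quarter (s : ℂ) : (-I * (s - 1 / 2)) ^ 2 + 1 / 4 = s * (1 - s) := by
  have h1 : (-I * (s - 1 / 2)) ^ 2 = -(s - 1 / 2) ^ 2 := by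
    rw [mul_pow, neg_pow, Complex.I_sq]; ring
  rw [h1]; ring

variable {κ : ℝ} (w : ℂ)

/-- `y ↦ G_n(κy, w)` has derivative `-κ G_{n+1}(κy, w)` at `y > 0`. [folklore] -/
theorem hasDerivAt_polyaG_comp_mul (hκ : 0 < κ) (n : ℕ) {y : ℝ} (hy : 0 < y) :
    HasDerivAt (fun t : ℝ => polyaG n (κ * t) w) (-(κ : ℂ) * polyaG (n + 1) (κ * y) w) y := by
  have h1 : HasDerivAt (fun t : ℝ => κ * t) κ y := by
    simpa using (hasDerivAt_id y).const_mul κ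
  have h2 := hasDerivAt_polyaG (mul_pos hκ hy) n w
  have h := h2.scomp y h1
  refine h.congr_deriv ?_
  rw [Complex.real_smul]
  ring

omit w in
/-- `y ↦ √y` (as a complex number) has derivative `1/(2√y)` at `y > 0`. [folklore] -/
theorem hasDerivAt_ofReal_sqrt {y : ℝ} (hy : 0 < y) :
    HasDerivAt (fun t : ℝ => (Real.sqrt t : ℂ)) (1 / (2 * (Real.sqrt y : ℂ))) y := by
  have h := (Real.hasDerivAt_sqrt hy.ne').ofReal_comp
  refine h.congr_deriv ?_
  push_cast
  ring

/-- **`k' = k₁`**: the Bessel mode is differentiable on `(0, ∞)` with the stated derivative. [folklore] -/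
theorem hasDerivAt_besselMode {y : ℝ} (hy : 0 < y) (hκ : 0 < κ) :
    HasDerivAt (besselMode κ w) (besselMode₁ κ w y) y := by
  have h := (hasDerivAt_ofReal_sqrt hy).mul (hasDerivAt_polyaG_comp_mul w hκ 0 hy)
  refine h.congr_deriv ?_
  simp only [besselMode₁, zero_add]
  ring

/-- **`k₁' = (κ² - (w² + 1/4)/y²) k`**: the Bessel mode solves `y² k'' = (κ²y² - (w² + 1/4)) k`,
from Pólya's equation `x² G₂ - x G₁ + (w² - x²) G₀ = 0` at `x = κy`.
[cite: Iwaniec2002, (1.25), PDF p. 17] -/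
theorem hasDerivAt_besselMode₁ {y : ℝ} (hy : 0 < y) (hκ : 0 < κ) :
    HasDerivAt (besselMode₁ κ w)
      (((κ : ℂ) ^ 2 - (w ^ 2 + 1 / 4) / (y : ℂ) ^ 2) * besselMode κ w y) y := by
  have hS0 : (Real.sqrt y : ℂ) ≠ 0 := by
    exact_mod_cast (Real.sqrt_pos.mpr hy).ne'
  have hS2 : (Real.sqrt y : ℂ) ^ 2 = (y : ℂ) := by
    rw [← Complex.ofReal_pow, Real.sq_sqrt hy.le]
  have hy0 : (y : ℂ) ≠ 0 := Complex.ofReal_ne_zero.mpr hy.ne'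
  -- the two pieces
  have hA : HasDerivAt (fun t : ℝ => polyaG 0 (κ * t) w / (2 * (Real.sqrt t : ℂ)))
      ((-(κ : ℂ) * polyaG 1 (κ * y) w * (2 * (Real.sqrt y : ℂ)) -
        polyaG 0 (κ * y) w * (2 * (1 / (2 * (Real.sqrt y : ℂ))))) / (2 * (Real.sqrt y : ℂ)) ^ 2) y := by
    have h1 := hasDerivAt_polyaG_comp_mul w hκ 0 hy
    have h2 : HasDerivAt (fun t : ℝ => 2 * (Real.sqrt t : ℂ)) (2 * (1 / (2 * (Real.sqrt y : ℂ)))) y :=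
      (hasDerivAt_ofReal_sqrt hy).const_mul 2
    exact h1.div h2 (mul_ne_zero two_ne_zero hS0)
  have hB : HasDerivAt (fun t : ℝ => (κ : ℂ) * (Real.sqrt t : ℂ) * polyaG 1 (κ * t) w)
      ((κ : ℂ) * (1 / (2 * (Real.sqrt y : ℂ))) * polyaG 1 (κ * y) w +
        (κ : ℂ) * (Real.sqrt y : ℂ) * (-(κ : ℂ) * polyaG (1 + 1) (κ * y) w)) y := by
    have h1 := ((hasDerivAt_ofReal_sqrt hy).const_mul (κ : ℂ)).mul (hasDerivAt_polyaG_comp_mul w hκ 1 hy)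
    exact h1
  have h := hA.sub hB
  refine h.congr_deriv ?_
  -- Pólya's ODE at `x = κ y`
  have hode := polyaG_ode (mul_pos hκ hy) w
  simp only [besselMode]
  rw [show (1 + 1 : ℕ) = 2 from rfl] at hB ⊢
  push_cast at hode ⊢
  -- replace `y` by `S²`
  set S : ℂ := (Real.sqrt y : ℂ) with hS
  rw [← hS2] at hode ⊢
  set G0 := polyaG 0 (κ * y) w
  set G1 := polyaG 1 (κ * y) w
  set G2 := polyaG 2 (κ * y) w
  have h4 : (4 : ℂ) * S ^ 3 ≠ 0 := mul_ne_zero (by norm_num) (pow_ne_zero 3 hS0)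
  apply mul_left_cancel₀ h4
  have e : 4 * S ^ 3 * ((-(κ : ℂ) * G1 * (2 * S) - G0 * (2 * (1 / (2 * S)))) / (2 * S) ^ 2 -
        ((κ : ℂ) * (1 / (2 * S)) * G1 + (κ : ℂ) * S * (-(κ : ℂ) * G2))) -
      4 * S ^ 3 * (((κ : ℂ) ^ 2 - (w ^ 2 + 1 / 4) / (S ^ 2) ^ 2) * (S * G0)) =
      4 * (((κ : ℂ) * S ^ 2) ^ 2 * G2 - (κ : ℂ) * S ^ 2 * G1 + (w ^ 2 - ((κ : ℂ) * S ^ 2) ^ 2) * G0) := by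
    field_simp
    ring
  linear_combination e + 4 * hode

omit w in
/-- A common constant for the decay of `k` and `k₁` on `[1, ∞)`. [folklore] -/
def besselModeConst (κ : ℝ) (w : ℂ) : ℝ :=
  2 * Real.sqrt (2 * π) * Real.exp ((1 + ‖w‖) ^ 2 / (2 * κ)) * ((1 + κ) / Real.sqrt κ)

/-- `0 ≤ besselModeConst` (`κ > 0`). [folklore] -/
theorem besselModeConst_nonneg (hκ : 0 < κ) : 0 ≤ besselModeConst κ w := by
  unfold besselModeConst
  positivity

/-- **Decay of the Bessel mode**: `‖k(y)‖ ≤ C e^{-κy}` for `y ≥ 1`. [folklore] -/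
theorem norm_besselMode_le (hκ : 0 < κ) {y : ℝ} (hy : 1 ≤ y) :
    ‖besselMode κ w y‖ ≤ besselModeConst κ w * Real.exp (-(κ * y)) := by
  have hy0 : 0 < y := by linarith
  have hx : κ ≤ κ * y := by nlinarith
  have h0 := norm_polyaG_le_exp_div_sqrt hκ hx 0 w
  simp only [Nat.cast_zero, zero_add] at h0
  rw [besselMode, norm_mul, Complex.norm_real, Real.norm_eq_abs, abs_of_nonneg (Real.sqrt_nonneg y)]
  have hsq : Real.sqrt (κ * y) = Real.sqrt κ * Real.sqrt y := Real.sqrt_mul hκ.le y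
  have hsy : 0 < Real.sqrt y := Real.sqrt_pos.mpr hy0
  have hsκ : 0 < Real.sqrt κ := Real.sqrt_pos.mpr hκ
  calc Real.sqrt y * ‖polyaG 0 (κ * y) w‖
      ≤ Real.sqrt y * ((2 * Real.sqrt (2 * π) * Real.exp (‖w‖ ^ 2 / (2 * κ))) *
          (Real.exp (-(κ * y)) / Real.sqrt (κ * y))) := by gcongr
    _ = (2 * Real.sqrt (2 * π) * Real.exp (‖w‖ ^ 2 / (2 * κ)) * (1 / Real.sqrt κ)) * Real.exp (-(κ * y)) := by
        rw [hsq]; field_simp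
    _ ≤ besselModeConst κ w * Real.exp (-(κ * y)) := by
        unfold besselModeConst
        gcongr
        · nlinarith [norm_nonneg w]
        · linarith

/-- **Decay of the derivative of the Bessel mode**: `‖k₁(y)‖ ≤ C e^{-κy}` for `y ≥ 1`. [folklore] -/
theorem norm_besselMode₁_le (hκ : 0 < κ) {y : ℝ} (hy : 1 ≤ y) :
    ‖besselMode₁ κ w y‖ ≤ besselModeConst κ w * Real.exp (-(κ * y)) := by
  have hy0 : 0 < y := by linarith
  have hx : κ ≤ κ * y := by nlinarith
  have h0 := norm_polyaG_le_exp_div_sqrt hκ hx 0 w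
  have h1 := norm_polyaG_le_exp_div_sqrt hκ hx 1 w
  simp only [Nat.cast_zero, zero_add, Nat.cast_one] at h0 h1
  have hsq : Real.sqrt (κ * y) = Real.sqrt κ * Real.sqrt y := Real.sqrt_mul hκ.le y
  have hsy : 0 < Real.sqrt y := Real.sqrt_pos.mpr hy0
  have hsy1 : 1 ≤ Real.sqrt y := by rw [← Real.sqrt_one]; exact Real.sqrt_le_sqrt hy
  have hsκ : 0 < Real.sqrt κ := Real.sqrt_pos.mpr hκ
  have hE0 : Real.exp (‖w‖ ^ 2 / (2 * κ)) ≤ Real.exp ((1 + ‖w‖) ^ 2 / (2 * κ)) := by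
    apply Real.exp_le_exp.2; gcongr; nlinarith [norm_nonneg w]
  rw [besselMode₁]
  refine (norm_sub_le _ _).trans ?_
  have hn1 : ‖polyaG 0 (κ * y) w / (2 * (Real.sqrt y : ℂ))‖ = ‖polyaG 0 (κ * y) w‖ / (2 * Real.sqrt y) := by
    rw [norm_div, norm_mul, Complex.norm_two, Complex.norm_real, Real.norm_eq_abs,
      abs_of_nonneg (Real.sqrt_nonneg y)]
  have hn2 : ‖(κ : ℂ) * (Real.sqrt y : ℂ) * polyaG 1 (κ * y) w‖ = κ * Real.sqrt y * ‖polyaG 1 (κ * y) w‖ := by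
    rw [norm_mul, norm_mul, Complex.norm_real, Complex.norm_real, Real.norm_eq_abs, Real.norm_eq_abs,
      abs_of_nonneg (Real.sqrt_nonneg y), abs_of_pos hκ]
  rw [hn1, hn2]
  set E : ℝ := Real.exp (-(κ * y)) with hE
  have hEpos : 0 < E := Real.exp_pos _
  set A : ℝ := 2 * Real.sqrt (2 * π) * Real.exp ((1 + ‖w‖) ^ 2 / (2 * κ)) with hA
  have hApos : 0 < A := by positivity
  -- first term
  have t1 : ‖polyaG 0 (κ * y) w‖ / (2 * Real.sqrt y) ≤ A * (1 / Real.sqrt κ) * E / 2 := by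
    have : ‖polyaG 0 (κ * y) w‖ ≤ A * (E / (Real.sqrt κ * Real.sqrt y)) := by
      calc ‖polyaG 0 (κ * y) w‖ ≤ (2 * Real.sqrt (2 * π) * Real.exp (‖w‖ ^ 2 / (2 * κ))) *
            (E / Real.sqrt (κ * y)) := h0
        _ ≤ A * (E / Real.sqrt (κ * y)) :=
            mul_le_mul_of_nonneg_right (mul_le_mul_of_nonneg_left hE0 (by positivity)) (by positivity)
        _ = _ := by rw [hsq]
    calc ‖polyaG 0 (κ * y) w‖ / (2 * Real.sqrt y) ≤ A * (E / (Real.sqrt κ * Real.sqrt y)) / (2 * Real.sqrt y) := by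
          gcongr
      _ = A * (1 / Real.sqrt κ) * E / 2 * (1 / (Real.sqrt y * Real.sqrt y)) := by
          field_simp
      _ ≤ A * (1 / Real.sqrt κ) * E / 2 * 1 := by
          gcongr
          rw [div_le_one (by positivity)]
          nlinarith
      _ = _ := mul_one _
  -- second term
  have t2 : κ * Real.sqrt y * ‖polyaG 1 (κ * y) w‖ ≤ A * Real.sqrt κ * E := by
    calc κ * Real.sqrt y * ‖polyaG 1 (κ * y) w‖ ≤ κ * Real.sqrt y * (A * (E / Real.sqrt (κ * y))) := by
          gcongr
      _ = A * (κ / Real.sqrt κ) * E := by rw [hsq]; field_simp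
      _ = A * Real.sqrt κ * E := by rw [Real.div_sqrt]
  calc ‖polyaG 0 (κ * y) w‖ / (2 * Real.sqrt y) + κ * Real.sqrt y * ‖polyaG 1 (κ * y) w‖
      ≤ A * (1 / Real.sqrt κ) * E / 2 + A * Real.sqrt κ * E := add_le_add t1 t2
    _ ≤ besselModeConst κ w * E := by
        rw [besselModeConst, ← hA]
        have hk : A * (1 / Real.sqrt κ) * E / 2 + A * Real.sqrt κ * E =
            A * ((1 / 2 + κ) / Real.sqrt κ) * E := by
          field_simp
          rw [Real.sq_sqrt hκ.le]
          ring
        rw [hk]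
        gcongr
        norm_num

/-- **The Bessel mode is not identically zero** (`Re G₀(x, w) > 0` for large `x`, Pólya). [folklore] -/
theorem exists_besselMode_ne_zero (hκ : 0 < κ) : ∃ y₁ : ℝ, 0 < y₁ ∧ besselMode κ w y₁ ≠ 0 := by
  obtain ⟨x, -, hx0, hx⟩ := exists_polyaG_zero_ne_zero 0 w
  refine ⟨x / κ, div_pos hx0 hκ, ?_⟩
  rw [besselMode, mul_div_cancel₀ x hκ.ne']
  refine mul_ne_zero ?_ hx
  exact_mod_cast (Real.sqrt_pos.mpr (div_pos hx0 hκ)).ne'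

end Whittaker

/-! ## 3. Linear second-order equations `u'' = q u` on `(0, ∞)`: the growth dichotomy -/

section LinearODE

variable {q : ℝ → ℂ}

/-- **Uniqueness for `g'' = q g` on `(0, ∞)`**: if `g' = p`, `p' = q g` on `(0,∞)` with `q`
continuous there and `g(y₁) = p(y₁) = 0` for some `y₁ > 0`, then `g ≡ 0` on `(0, ∞)` (Grönwall,
through Mathlib's `ODE_solution_unique_of_mem_Ioo` for the system `(g, p)' = (p, q g)`). [folklore] -/
theorem linearODE_eq_zero (hq : ContinuousOn q (Ioi 0)) {g p : ℝ → ℂ}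
    (hg : ∀ y, 0 < y → HasDerivAt g (p y) y) (hp : ∀ y, 0 < y → HasDerivAt p (q y * g y) y)
    {y₁ : ℝ} (hy₁ : 0 < y₁) (hg₁ : g y₁ = 0) (hp₁ : p y₁ = 0) {y : ℝ} (hy : 0 < y) : g y = 0 := by
  set a : ℝ := min y y₁ / 2 with ha_def
  set b : ℝ := max y y₁ + 1 with hb_def
  have ha : 0 < a := by rw [ha_def]; positivity
  have hay : a < y := by
    rw [ha_def]; have := min_le_left y y₁; linarith
  have hay₁ : a < y₁ := by
    rw [ha_def]; have := min_le_right y y₁; linarith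
  have hyb : y < b := by rw [hb_def]; have := le_max_left y y₁; linarith
  have hy₁b : y₁ < b := by rw [hb_def]; have := le_max_right y y₁; linarith
  -- a bound for `q` on `[a, b]`
  obtain ⟨M, hM⟩ := (isCompact_Icc (a := a) (b := b)).exists_bound_of_continuousOn
    (hq.mono fun t ht => lt_of_lt_of_le ha ht.1)
  set K : NNReal := max 1 (Real.toNNReal M) with hK
  set v : ℝ → ℂ × ℂ → ℂ × ℂ := fun t x => (x.2, q t • x.1) with hv_def
  have hv : ∀ t ∈ Ioo a b, LipschitzOnWith K (v t) univ := by
    intro t ht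
    have h1 : LipschitzWith 1 (fun x : ℂ × ℂ => x.2) := LipschitzWith.prod_snd
    have h2 : LipschitzWith (‖q t‖₊ * 1) (fun x : ℂ × ℂ => q t • x.1) :=
      (lipschitzWith_smul (q t)).comp LipschitzWith.prod_fst
    have h3 := h1.prodMk h2
    refine (h3.weaken ?_).lipschitzOnWith
    rw [mul_one]
    refine max_le_max le_rfl ?_
    have hqt : ‖q t‖ ≤ M := hM t (Ioo_subset_Icc_self ht)
    change (‖q t‖₊ : ℝ) ≤ Real.toNNReal M
    rw [coe_nnnorm]
    exact hqt.trans (Real.le_coe_toNNReal M)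
  have hsol : ∀ t ∈ Ioo a b, HasDerivAt (fun t => (g t, p t)) (v t (g t, p t)) t ∧ (g t, p t) ∈ univ := by
    intro t ht
    have ht0 : 0 < t := ha.trans ht.1
    refine ⟨?_, trivial⟩
    have h := (hg t ht0).prodMk (hp t ht0)
    simpa [hv_def, smul_eq_mul] using h
  have hzero : ∀ t ∈ Ioo a b, HasDerivAt (fun _ : ℝ => ((0 : ℂ), (0 : ℂ))) (v t ((0 : ℂ), (0 : ℂ))) t ∧
      ((0 : ℂ), (0 : ℂ)) ∈ univ := by
    intro t _
    refine ⟨?_, trivial⟩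
    have : v t ((0 : ℂ), (0 : ℂ)) = ((0 : ℂ), (0 : ℂ)) := by simp [hv_def]
    rw [this]
    exact hasDerivAt_const t _
  have heq : (fun t => (g t, p t)) y₁ = ((0 : ℂ), (0 : ℂ)) := by simp [hg₁, hp₁]
  have key := ODE_solution_unique_of_mem_Ioo hv ⟨hay₁, hy₁b⟩ hsol hzero heq ⟨hay, hyb⟩
  simp only [Prod.mk.injEq] at key
  exact key.1

/-- **The Wronskian of two solutions of `u'' = q u` is constant** on `(0, ∞)`. [folklore] -/
theorem wronskian_const {k k₁ b p : ℝ → ℂ}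
    (hk : ∀ y, 0 < y → HasDerivAt k (k₁ y) y) (hk₁ : ∀ y, 0 < y → HasDerivAt k₁ (q y * k y) y)
    (hb : ∀ y, 0 < y → HasDerivAt b (p y) y) (hp : ∀ y, 0 < y → HasDerivAt p (q y * b y) y) :
    ∃ β : ℂ, ∀ y, 0 < y → k y * p y - k₁ y * b y = β := by
  refine exists_const_of_hasDerivAt_zero_Ioi fun y hy => ?_
  have h := ((hk y hy).mul (hp y hy)).sub ((hk₁ y hy).mul (hb y hy))
  refine h.congr_deriv ?_
  ring

/-- **A solution proportional to `k` beyond the Wronskian**: if the Wronskian `k p − k₁ b` of two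
solutions vanishes identically and `k(y₁) ≠ 0`, then `b = (b(y₁)/k(y₁)) k` on `(0, ∞)`. [folklore] -/
theorem eq_const_mul_of_wronskian_zero (hq : ContinuousOn q (Ioi 0)) {k k₁ b p : ℝ → ℂ}
    (hk : ∀ y, 0 < y → HasDerivAt k (k₁ y) y) (hk₁ : ∀ y, 0 < y → HasDerivAt k₁ (q y * k y) y)
    (hb : ∀ y, 0 < y → HasDerivAt b (p y) y) (hp : ∀ y, 0 < y → HasDerivAt p (q y * b y) y)
    (hW : ∀ y, 0 < y → k y * p y - k₁ y * b y = 0) {y₁ : ℝ} (hy₁ : 0 < y₁) (hk0 : k y₁ ≠ 0) :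
    ∀ y, 0 < y → b y = b y₁ / k y₁ * k y := by
  set c : ℂ := b y₁ / k y₁ with hc
  -- `g = b - c k` solves the equation and vanishes with its derivative at `y₁`
  have hg : ∀ y, 0 < y → HasDerivAt (fun t => b t - c * k t) (p y - c * k₁ y) y := fun y hy =>
    (hb y hy).sub ((hk y hy).const_mul c)
  have hp' : ∀ y, 0 < y → HasDerivAt (fun t => p t - c * k₁ t) (q y * (b y - c * k y)) y := by
    intro y hy
    have h := (hp y hy).sub ((hk₁ y hy).const_mul c)
    refine h.congr_deriv ?_
    ring
  have hg₁ : b y₁ - c * k y₁ = 0 := by rw [hc, div_mul_cancel₀ _ hk0, sub_self]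
  have hp₁ : p y₁ - c * k₁ y₁ = 0 := by
    have h := hW y₁ hy₁
    have : k y₁ * (p y₁ - c * k₁ y₁) = 0 := by
      have e : k y₁ * (p y₁ - c * k₁ y₁) = (k y₁ * p y₁ - k₁ y₁ * b y₁) + k₁ y₁ * (b y₁ - c * k y₁) := by
        ring
      rw [e, h, hg₁, mul_zero, add_zero]
    exact (mul_eq_zero.mp this).resolve_left hk0
  intro y hy
  have h := linearODE_eq_zero hq hg hp' hy₁ hg₁ hp₁ hy
  exact sub_eq_zero.mp h

/-- **The derivative of a solution is controlled by the solution on a unit interval**: for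
`b' = p`, `p' = q b` on `(0, ∞)` and `‖q b‖ ≤ S` on `[y, y+1]`,
`‖p(y)‖ ≤ ‖b(y+1)‖ + ‖b(y)‖ + S` (Taylor's formula with integral remainder). [folklore] -/
theorem norm_deriv_le_of_solution (hq : ContinuousOn q (Ioi 0)) {b p : ℝ → ℂ} {y S : ℝ} (hy : 0 < y)
    (hb : ∀ t, 0 < t → HasDerivAt b (p t) t) (hp : ∀ t, 0 < t → HasDerivAt p (q t * b t) t)
    (hS : ∀ t ∈ Icc y (y + 1), ‖q t * b t‖ ≤ S) :
    ‖p y‖ ≤ ‖b (y + 1)‖ + ‖b y‖ + S := by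
  have hy1 : y ≤ y + 1 := by linarith
  -- continuity of `p`, `b`, `q b` on `[y, y+1]`
  have hpc : ContinuousOn p (Icc y (y + 1)) := fun t ht =>
    (hp t (hy.trans_le ht.1)).continuousAt.continuousWithinAt
  have hbc : ContinuousOn b (Icc y (y + 1)) := fun t ht =>
    (hb t (hy.trans_le ht.1)).continuousAt.continuousWithinAt
  have hqbc : ContinuousOn (fun t => q t * b t) (Icc y (y + 1)) :=
    (hq.mono fun t ht => hy.trans_le ht.1).mul hbc
  -- `R t = p t - p y = ∫_y^t q b`, bounded by `S (t - y) ≤ S`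
  have hR : ∀ t ∈ Icc y (y + 1), ‖p t - p y‖ ≤ S := by
    intro t ht
    have hft : p t - p y = ∫ u in y..t, q u * b u := by
      rw [intervalIntegral.integral_eq_sub_of_hasDerivAt]
      · intro u hu
        rw [uIcc_of_le ht.1] at hu
        exact hp u (hy.trans_le hu.1)
      · exact (hqbc.mono (Icc_subset_Icc_right ht.2)).intervalIntegrable_of_Icc ht.1
    rw [hft]
    have h1 : ‖∫ u in y..t, q u * b u‖ ≤ S * |t - y| := by
      refine intervalIntegral.norm_integral_le_of_norm_le_const fun u hu => ?_
      rw [uIoc_of_le ht.1] at hu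
      exact hS u ⟨hu.1.le, hu.2.trans ht.2⟩
    have h2 : |t - y| ≤ 1 := by rw [abs_of_nonneg (by linarith [ht.1])]; linarith [ht.2]
    have hS0 : 0 ≤ S := (norm_nonneg _).trans (hS y ⟨le_rfl, hy1⟩)
    calc ‖∫ u in y..t, q u * b u‖ ≤ S * |t - y| := h1
      _ ≤ S * 1 := by gcongr
      _ = S := mul_one S
  -- `b(y+1) - b(y) = ∫_y^{y+1} p = p y + ∫ (p t - p y) dt`
  have hFTC : (∫ t in y..y + 1, p t) = b (y + 1) - b y := by
    rw [intervalIntegral.integral_eq_sub_of_hasDerivAt]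
    · intro u hu
      rw [uIcc_of_le hy1] at hu
      exact hb u (hy.trans_le hu.1)
    · exact hpc.intervalIntegrable_of_Icc hy1
  have hsplit : (∫ t in y..y + 1, p t) = p y + ∫ t in y..y + 1, (p t - p y) := by
    have hi1 : IntervalIntegrable (fun t => p t - p y) volume y (y + 1) :=
      (hpc.sub continuousOn_const).intervalIntegrable_of_Icc hy1
    have hi2 : IntervalIntegrable (fun _ => p y) volume y (y + 1) := intervalIntegrable_const
    have : (fun t => p t) = fun t => (fun _ => p y) t + (p t - p y) := by funext t; ring
    rw [this, intervalIntegral.integral_add hi2 hi1, intervalIntegral.integral_const]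
    simp
  have hrem : ‖∫ t in y..y + 1, (p t - p y)‖ ≤ S := by
    have h1 : ‖∫ t in y..y + 1, (p t - p y)‖ ≤ S * |y + 1 - y| := by
      refine intervalIntegral.norm_integral_le_of_norm_le_const fun u hu => ?_
      rw [uIoc_of_le hy1] at hu
      exact hR u ⟨hu.1.le, hu.2⟩
    simpa using h1
  have hpy : p y = (b (y + 1) - b y) - ∫ t in y..y + 1, (p t - p y) := by
    rw [← hFTC, hsplit]; ring
  calc ‖p y‖ = ‖(b (y + 1) - b y) - ∫ t in y..y + 1, (p t - p y)‖ := by rw [← hpy]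
    _ ≤ ‖b (y + 1) - b y‖ + ‖∫ t in y..y + 1, (p t - p y)‖ := norm_sub_le _ _
    _ ≤ (‖b (y + 1)‖ + ‖b y‖) + S := add_le_add (norm_sub_le _ _) hrem
    _ = _ := by ring

/-- **Growth selects the decaying solution.** Let `κ > 0`, `q(y) = κ² − μ/y²`, and let `k` be a
solution of `k'' = q k` on `(0, ∞)` (with derivative `k₁`), not identically zero, with
`‖k(y)‖, ‖k₁(y)‖ ≤ C e^{−κy}` for `y ≥ 1`. Then every solution `b` (derivative `p`) with
`b(y) = o(e^{κy})` is a constant multiple of `k` — the Wronskian `k p − k₁ b` is a constant which the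
bounds force to be `0` ("this condition rules out the second solution", Iwaniec p. 20 on (1.25)).
[cite: Iwaniec2002, (1.25)–(1.26), PDF pp. 17, 20] -/
theorem exists_eq_const_mul_of_growth {κ : ℝ} (hκ : 0 < κ) (μ : ℂ)
    (hq : ∀ y, 0 < y → q y = (κ : ℂ) ^ 2 - μ / (y : ℂ) ^ 2)
    {k k₁ b p : ℝ → ℂ} {C : ℝ}
    (hk : ∀ y, 0 < y → HasDerivAt k (k₁ y) y) (hk₁ : ∀ y, 0 < y → HasDerivAt k₁ (q y * k y) y)
    (hkb : ∀ y, 1 ≤ y → ‖k y‖ ≤ C * Real.exp (-(κ * y)))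
    (hk₁b : ∀ y, 1 ≤ y → ‖k₁ y‖ ≤ C * Real.exp (-(κ * y)))
    (hk0 : ∃ y₁, 0 < y₁ ∧ k y₁ ≠ 0)
    (hb : ∀ y, 0 < y → HasDerivAt b (p y) y) (hp : ∀ y, 0 < y → HasDerivAt p (q y * b y) y)
    (hgrowth : ∀ ε, 0 < ε → ∃ Y, ∀ y, Y ≤ y → ‖b y‖ ≤ ε * Real.exp (κ * y)) :
    ∃ c : ℂ, ∀ y, 0 < y → b y = c * k y := by
  -- continuity of `q` on `(0, ∞)`
  have hqc : ContinuousOn q (Ioi 0) := by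
    have h : ContinuousOn (fun y : ℝ => (κ : ℂ) ^ 2 - μ / (y : ℂ) ^ 2) (Ioi 0) := by
      apply ContinuousOn.sub continuousOn_const
      apply ContinuousOn.div continuousOn_const (by fun_prop)
      intro y hy
      exact pow_ne_zero 2 (Complex.ofReal_ne_zero.mpr (ne_of_gt hy))
    exact h.congr fun y hy => hq y hy
  obtain ⟨β, hβ⟩ := wronskian_const hk hk₁ hb hp
  -- the Wronskian vanishes
  have hC0 : 0 ≤ C := by
    have h := hkb 1 le_rfl
    have : 0 ≤ C * Real.exp (-(κ * 1)) := (norm_nonneg _).trans h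
    exact nonneg_of_mul_nonneg_left this (Real.exp_pos _)
  set A : ℝ := (2 + κ ^ 2 + ‖μ‖) * Real.exp κ + 1 with hA
  have hA0 : 0 < A := by positivity
  have hβ0 : β = 0 := by
    by_contra hne
    have hβpos : 0 < ‖β‖ := norm_pos_iff.mpr hne
    obtain ⟨Y, hY⟩ := hgrowth (‖β‖ / (2 * (C * A + 1))) (by positivity)
    set y : ℝ := max Y 1 with hy_def
    have hy1 : 1 ≤ y := le_max_right _ _
    have hy0 : 0 < y := by linarith
    have hYy : Y ≤ y := le_max_left _ _
    set ε : ℝ := ‖β‖ / (2 * (C * A + 1)) with hε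
    have hε0 : 0 < ε := by positivity
    -- bounds for `b` on `[y, y+1]`
    have hbI : ∀ t ∈ Icc y (y + 1), ‖b t‖ ≤ ε * Real.exp κ * Real.exp (κ * y) := by
      intro t ht
      have h1 := hY t (hYy.trans ht.1)
      calc ‖b t‖ ≤ ε * Real.exp (κ * t) := h1
        _ ≤ ε * Real.exp (κ * (y + 1)) := by gcongr; exact ht.2
        _ = ε * Real.exp κ * Real.exp (κ * y) := by rw [mul_add, mul_one, Real.exp_add]; ring
    have hqI : ∀ t ∈ Icc y (y + 1), ‖q t‖ ≤ κ ^ 2 + ‖μ‖ := by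
      intro t ht
      have ht0 : 0 < t := by linarith [ht.1]
      have ht1 : 1 ≤ t := hy1.trans ht.1
      rw [hq t ht0]
      refine (norm_sub_le _ _).trans (add_le_add ?_ ?_)
      · rw [norm_pow, Complex.norm_real, Real.norm_eq_abs, abs_of_pos hκ]
      · rw [norm_div, norm_pow, Complex.norm_real, Real.norm_eq_abs, abs_of_pos ht0]
        apply div_le_self (norm_nonneg _)
        nlinarith
    have hS : ∀ t ∈ Icc y (y + 1), ‖q t * b t‖ ≤ (κ ^ 2 + ‖μ‖) * (ε * Real.exp κ * Real.exp (κ * y)) := by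
      intro t ht
      rw [norm_mul]
      exact mul_le_mul (hqI t ht) (hbI t ht) (norm_nonneg _) (by positivity)
    have hpy := norm_deriv_le_of_solution hqc hy0 hb hp hS
    have hby : ‖b y‖ ≤ ε * Real.exp (κ * y) := hY y hYy
    have hby1 : ‖b (y + 1)‖ ≤ ε * Real.exp κ * Real.exp (κ * y) := hbI (y + 1) ⟨by linarith, le_rfl⟩
    have hexpκ : 1 ≤ Real.exp κ := Real.one_le_exp hκ.le
    have hE : 0 < Real.exp (κ * y) := Real.exp_pos _
    have hpy' : ‖p y‖ ≤ (2 + κ ^ 2 + ‖μ‖) * Real.exp κ * (ε * Real.exp (κ * y)) := by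
      have h1 : ‖b y‖ ≤ ε * Real.exp κ * Real.exp (κ * y) := by
        calc ‖b y‖ ≤ ε * Real.exp (κ * y) := hby
          _ = ε * 1 * Real.exp (κ * y) := by ring
          _ ≤ ε * Real.exp κ * Real.exp (κ * y) := by gcongr
      calc ‖p y‖ ≤ ‖b (y + 1)‖ + ‖b y‖ + (κ ^ 2 + ‖μ‖) * (ε * Real.exp κ * Real.exp (κ * y)) := hpy
        _ ≤ ε * Real.exp κ * Real.exp (κ * y) + ε * Real.exp κ * Real.exp (κ * y) +
            (κ ^ 2 + ‖μ‖) * (ε * Real.exp κ * Real.exp (κ * y)) := by gcongr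
        _ = (2 + κ ^ 2 + ‖μ‖) * Real.exp κ * (ε * Real.exp (κ * y)) := by ring
    -- the Wronskian at `y`
    have hW := hβ y hy0
    have hky := hkb y hy1
    have hk₁y := hk₁b y hy1
    have hee : Real.exp (-(κ * y)) * Real.exp (κ * y) = 1 := by
      rw [← Real.exp_add]; simp
    have hβle : ‖β‖ ≤ C * A * ε := by
      rw [← hW]
      calc ‖k y * p y - k₁ y * b y‖ ≤ ‖k y‖ * ‖p y‖ + ‖k₁ y‖ * ‖b y‖ := by
            refine (norm_sub_le _ _).trans ?_; rw [norm_mul, norm_mul]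
        _ ≤ C * Real.exp (-(κ * y)) * ((2 + κ ^ 2 + ‖μ‖) * Real.exp κ * (ε * Real.exp (κ * y))) +
            C * Real.exp (-(κ * y)) * (ε * Real.exp (κ * y)) := by
            gcongr
        _ = C * ((2 + κ ^ 2 + ‖μ‖) * Real.exp κ + 1) * ε * (Real.exp (-(κ * y)) * Real.exp (κ * y)) := by
            ring
        _ = C * A * ε := by rw [hee, mul_one]
    -- contradiction: `‖β‖ ≤ C A ε = C A ‖β‖ / (2 (C A + 1)) < ‖β‖`
    have : C * A * ε < ‖β‖ := by
      rw [hε]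
      have hCA : 0 ≤ C * A := by positivity
      rw [show C * A * (‖β‖ / (2 * (C * A + 1))) = ‖β‖ * (C * A / (2 * (C * A + 1))) by ring]
      have hlt : C * A / (2 * (C * A + 1)) < 1 := by
        rw [div_lt_one (by positivity)]; nlinarith
      calc ‖β‖ * (C * A / (2 * (C * A + 1))) < ‖β‖ * 1 := by gcongr
        _ = ‖β‖ := mul_one _
    linarith
  obtain ⟨y₁, hy₁, hk0⟩ := hk0
  refine ⟨b y₁ / k y₁, eq_const_mul_of_wronskian_zero hqc hk hk₁ hb hp (fun y hy => ?_) hy₁ hk0⟩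
  rw [hβ y hy, hβ0]

end LinearODE


/-! ## 4. The twisted Fourier modes `a_n(y) = ∫₀¹ F(x+iy) e(-nx) dx` of a periodic eigenfunction -/

section TwistedModes

open Laplacian

/-- The character `e(-nx) = exp(-2πinx)` of the `n`-th Fourier mode. [folklore] -/
def eNeg (n : ℤ) (x : ℝ) : ℂ := Complex.exp (-(2 * π * I * n * x))

/-- `e(-n·0) = 1`. [folklore] -/
theorem eNeg_zero_right (n : ℤ) : eNeg n 0 = 1 := by simp [eNeg]

/-- `e(-n·1) = 1` for an integer `n`. [folklore] -/
theorem eNeg_one_right (n : ℤ) : eNeg n 1 = 1 := by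
  rw [eNeg]
  have : -(2 * (π : ℂ) * I * (n : ℂ) * ((1 : ℝ) : ℂ)) = ((-n : ℤ) : ℂ) * (2 * π * I) := by
    push_cast; ring
  rw [this, Complex.exp_int_mul_two_pi_mul_I]

/-- `|e(-nx)| = 1`. [folklore] -/
theorem norm_eNeg (n : ℤ) (x : ℝ) : ‖eNeg n x‖ = 1 := by
  rw [eNeg, Complex.norm_exp]
  have : (-(2 * (π : ℂ) * I * (n : ℂ) * (x : ℂ))).re = 0 := by
    simp [Complex.mul_re, Complex.mul_im]
  rw [this, Real.exp_zero]

/-- `e(-nx)` is continuous in `x`. [folklore] -/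
@[fun_prop]
theorem continuous_eNeg (n : ℤ) : Continuous (eNeg n) := by
  unfold eNeg; fun_prop

/-- `d/dx e(-nx) = -2πin · e(-nx)`. [folklore] -/
theorem hasDerivAt_eNeg (n : ℤ) (x : ℝ) : HasDerivAt (eNeg n) (-(2 * π * I * n) * eNeg n x) x := by
  have h1 : HasDerivAt (fun t : ℝ => (t : ℂ)) 1 x := by
    simpa using (hasDerivAt_id x).ofReal_comp
  have h2 : HasDerivAt (fun t : ℝ => Complex.exp (-(2 * (π : ℂ) * I * n * (t : ℂ))))
      (Complex.exp (-(2 * (π : ℂ) * I * n * (x : ℂ))) * -(2 * (π : ℂ) * I * n * 1)) x :=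
    ((h1.const_mul (2 * (π : ℂ) * I * n)).neg).cexp
  unfold eNeg
  refine h2.congr_deriv ?_
  ring

variable {F : ℂ → ℂ}

/-- **The `n`-th Fourier mode at height `y`**: `a_n(y) = ∫₀¹ F(x + iy) e(-nx) dx` (the coefficient
`f_{𝔞n}(y)` of (3.2) for `F = f ∘ σ_𝔞`). [cite: Iwaniec2002, (3.2), PDF p. 41] -/
def fourierMode (F : ℂ → ℂ) (n : ℤ) (y : ℝ) : ℂ :=
  ∫ x in (0 : ℝ)..1, F ((x : ℂ) + (y : ℂ) * Complex.I) * eNeg n x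

/-- The zero-th mode is the plain period integral. [folklore] -/
theorem fourierMode_zero (F : ℂ → ℂ) (y : ℝ) :
    fourierMode F 0 y = ∫ x in (0 : ℝ)..1, F ((x : ℂ) + (y : ℂ) * Complex.I) := by
  simp [fourierMode, eNeg]

/-- **Differentiation under `∫₀¹` in the vertical direction, with a continuous weight `φ(x)`.**
For `G` of class `C¹` on the open upper half-plane and `y > 0`,
`d/dy ∫₀¹ G(x+iy) φ(x) dx = ∫₀¹ G'(x+iy) I · φ(x) dx` (as `hasDerivAt_integral_vertical`). [folklore] -/
theorem hasDerivAt_integral_vertical_mul {G : ℂ → ℂ} (hG : ContDiffOn ℝ 1 G {z : ℂ | 0 < z.im})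
    {φ : ℝ → ℂ} (hφ : Continuous φ) {y : ℝ} (hy : 0 < y) :
    HasDerivAt (fun t : ℝ => ∫ x in (0 : ℝ)..1, G ((x : ℂ) + (t : ℂ) * Complex.I) * φ x)
      (∫ x in (0 : ℝ)..1, fderiv ℝ G ((x : ℂ) + (y : ℂ) * Complex.I) Complex.I * φ x) y := by
  set U : Set ℂ := {z : ℂ | 0 < z.im} with hU
  have hUo : IsOpen U := UpperHalfPlane.isOpen_upperHalfPlaneSet
  have hcont : ContinuousOn G U := hG.continuousOn
  have hcontd : ContinuousOn (fderiv ℝ G) U := hG.continuousOn_fderiv_of_isOpen hUo le_rfl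
  have hdiff : DifferentiableOn ℝ G U := hG.differentiableOn one_ne_zero
  set S : Set ℝ := Icc (y / 2) (2 * y) with hS
  have hSnhds : S ∈ 𝓝 y := Icc_mem_nhds (by linarith) (by linarith)
  set Φ : ℝ × ℝ → ℂ := fun p => (p.1 : ℂ) + (p.2 : ℂ) * Complex.I with hΦ
  have hΦc : Continuous Φ := by simp only [hΦ]; fun_prop
  set R : Set (ℝ × ℝ) := Icc (0 : ℝ) 1 ×ˢ S with hR
  have hRc : IsCompact R := isCompact_Icc.prod isCompact_Icc
  have hRU : ∀ p ∈ R, Φ p ∈ U := by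
    rintro ⟨t, s⟩ ⟨-, hs⟩
    simp only [hΦ, hU, mem_setOf_eq]
    have : y / 2 ≤ s := hs.1
    simpa using (by linarith : (0 : ℝ) < s)
  have hψ : ContinuousOn (fun p : ℝ × ℝ => fderiv ℝ G (Φ p) Complex.I) R :=
    ((hcontd.comp hΦc.continuousOn hRU).clm_apply continuousOn_const)
  obtain ⟨M, hM⟩ := hRc.exists_bound_of_continuousOn hψ
  obtain ⟨Mφ, hMφ⟩ := (isCompact_Icc (a := (0 : ℝ)) (b := 1)).exists_bound_of_continuousOn hφ.continuousOn
  have key := intervalIntegral.hasDerivAt_integral_of_dominated_loc_of_deriv_le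
    (μ := volume) (a := (0 : ℝ)) (b := 1) (𝕜 := ℝ)
    (F := fun (t : ℝ) (x : ℝ) => G ((x : ℂ) + (t : ℂ) * Complex.I) * φ x)
    (F' := fun (t : ℝ) (x : ℝ) => fderiv ℝ G ((x : ℂ) + (t : ℂ) * Complex.I) Complex.I * φ x)
    (x₀ := y) (bound := fun _ => M * Mφ) hSnhds ?_ ?_ ?_ ?_ ?_ ?_
  · exact key.2
  · filter_upwards [Ioi_mem_nhds hy] with t ht
    exact ((continuous_comp_horizontal hcont ht).mul hφ).aestronglyMeasurable
  · exact ((continuous_comp_horizontal hcont hy).mul hφ).intervalIntegrable _ _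
  · have hc : Continuous fun x : ℝ => fderiv ℝ G ((x : ℂ) + (y : ℂ) * Complex.I) Complex.I :=
      ((hcontd.comp_continuous (by fun_prop) fun t => by simpa [hU] using hy)).clm_apply
        continuous_const
    exact (hc.mul hφ).aestronglyMeasurable
  · refine Eventually.of_forall fun x hx t ht => ?_
    rw [uIoc_of_le zero_le_one] at hx
    rw [norm_mul]
    exact mul_le_mul (hM (x, t) ⟨⟨hx.1.le, hx.2⟩, ht⟩) (hMφ x ⟨hx.1.le, hx.2⟩) (norm_nonneg _)
      ((norm_nonneg _).trans (hM (x, t) ⟨⟨hx.1.le, hx.2⟩, ht⟩))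
  · exact intervalIntegrable_const
  · refine Eventually.of_forall fun x _ t ht => ?_
    have htpos : 0 < t := by have : y / 2 ≤ t := ht.1; linarith
    apply HasDerivAt.mul_const
    apply hasDerivAt_comp_vertical
    exact hdiff.differentiableAt (hUo.mem_nhds (by simpa [hU] using htpos))

variable (hF : ContDiffOn ℝ 2 F {z : ℂ | 0 < z.im})
include hF

/-- `a_n' (y) = ∫₀¹ F_y(x+iy) e(-nx) dx`. [folklore] -/
theorem hasDerivAt_fourierMode (n : ℤ) {y : ℝ} (hy : 0 < y) :
    HasDerivAt (fourierMode F n)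
      (∫ x in (0 : ℝ)..1, fderiv ℝ F ((x : ℂ) + (y : ℂ) * Complex.I) Complex.I * eNeg n x) y :=
  hasDerivAt_integral_vertical_mul (hF.of_le (by norm_num)) (continuous_eNeg n) hy

/-- `(∫₀¹ F_y e(-nx))' = ∫₀¹ F_yy(x+iy) e(-nx) dx`. [folklore] -/
theorem hasDerivAt_fourierMode_deriv (n : ℤ) {y : ℝ} (hy : 0 < y) :
    HasDerivAt (fun t : ℝ => ∫ x in (0 : ℝ)..1, fderiv ℝ F ((x : ℂ) + (t : ℂ) * Complex.I) Complex.I * eNeg n x)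
      (∫ x in (0 : ℝ)..1,
        fderiv ℝ (fderiv ℝ F) ((x : ℂ) + (y : ℂ) * Complex.I) Complex.I Complex.I * eNeg n x) y := by
  set G : ℂ → ℂ := fun w => fderiv ℝ F w Complex.I with hG
  have hG1 : ContDiffOn ℝ 1 G {z : ℂ | 0 < z.im} :=
    (hF.fderiv_of_isOpen UpperHalfPlane.isOpen_upperHalfPlaneSet (m := 1) (by norm_num)).clm_apply contDiffOn_const
  have h := hasDerivAt_integral_vertical_mul hG1 (continuous_eNeg n) hy
  have heq : (∫ x in (0 : ℝ)..1, fderiv ℝ G ((x : ℂ) + (y : ℂ) * Complex.I) Complex.I * eNeg n x) =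
      ∫ x in (0 : ℝ)..1,
        fderiv ℝ (fderiv ℝ F) ((x : ℂ) + (y : ℂ) * Complex.I) Complex.I Complex.I * eNeg n x := by
    apply intervalIntegral.integral_congr
    intro x _
    simp only [hG]
    rw [fderiv_fderiv_apply Complex.I Complex.I
      (differentiableAt_fderiv_of_C2 hF (im_pos_of_pt (x := x) hy))]
  rw [heq] at h
  exact h

/-- **Integration by parts, twice**: `∫₀¹ F_xx(x+iy) e(-nx) dx = -4π²n² a_n(y)` for a `1`-periodic
`C²` function (the boundary terms cancel by periodicity of `F`, `F_x` and `e(-nx)`). [folklore] -/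
theorem integral_fderiv_fderiv_one_one_mul_eNeg (hper : ∀ z : ℂ, 0 < z.im → F (z + 1) = F z)
    (n : ℤ) {y : ℝ} (hy : 0 < y) :
    (∫ x in (0 : ℝ)..1, fderiv ℝ (fderiv ℝ F) ((x : ℂ) + (y : ℂ) * Complex.I) 1 1 * eNeg n x) =
      -(4 * π ^ 2 * n ^ 2) * fourierMode F n y := by
  -- the functions of `x` and their derivatives
  set G0 : ℝ → ℂ := fun x => F ((x : ℂ) + (y : ℂ) * Complex.I) with hG0
  set G1 : ℝ → ℂ := fun x => fderiv ℝ F ((x : ℂ) + (y : ℂ) * Complex.I) 1 with hG1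
  set G2 : ℝ → ℂ := fun x => fderiv ℝ (fderiv ℝ F) ((x : ℂ) + (y : ℂ) * Complex.I) 1 1 with hG2
  have hd0 : ∀ x : ℝ, HasDerivAt G0 (G1 x) x := fun x =>
    hasDerivAt_comp_horizontal (differentiableAt_of_C2 hF (im_pos_of_pt (x := x) hy))
  have hd1 : ∀ x : ℝ, HasDerivAt G1 (G2 x) x := by
    intro x
    have hd := differentiableAt_fderiv_of_C2 hF (im_pos_of_pt (x := x) hy)
    have hGdiff : DifferentiableAt ℝ (fun w => fderiv ℝ F w 1) ((x : ℂ) + (y : ℂ) * Complex.I) :=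
      (hasFDerivAt_fderiv_apply 1 hd).differentiableAt
    have h := hasDerivAt_comp_horizontal (G := fun w => fderiv ℝ F w 1) hGdiff
    rw [fderiv_fderiv_apply 1 1 hd] at h
    exact h
  have hc0 : Continuous G0 := continuous_comp_horizontal hF.continuousOn hy
  have hc1 : Continuous G1 := by
    have h := (hF.continuousOn_fderiv_of_isOpen UpperHalfPlane.isOpen_upperHalfPlaneSet (by norm_num)).comp_continuous
      (f := fun x : ℝ => (x : ℂ) + (y : ℂ) * Complex.I) (by fun_prop) (fun x => im_pos_of_pt hy)
    exact h.clm_apply continuous_const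
  have hc2 : Continuous G2 := continuous_fderiv_fderiv_horizontal hF hy 1 1
  have hce : Continuous (eNeg n) := continuous_eNeg n
  have hce' : Continuous fun x => -(2 * π * I * n) * eNeg n x := by fun_prop
  -- periodicity of the boundary terms
  have hyI : 0 < ((y : ℂ) * Complex.I).im := by simpa using hy
  have hb0 : G0 1 = G0 0 := by
    simp only [hG0, Complex.ofReal_one, Complex.ofReal_zero, zero_add]
    rw [add_comm]
    exact hper _ hyI
  have hb1 : G1 1 = G1 0 := by
    simp only [hG1, Complex.ofReal_one, Complex.ofReal_zero, zero_add]
    rw [add_comm, fderiv_periodic hper hyI]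
  -- first integration by parts: `∫ G2 e = 2πin ∫ G1 e`
  have hparts1 := intervalIntegral.integral_deriv_mul_eq_sub (a := (0 : ℝ)) (b := 1)
    (u := G1) (v := eNeg n) (u' := G2) (v' := fun x => -(2 * π * I * n) * eNeg n x)
    (fun x _ => hd1 x) (fun x _ => hasDerivAt_eNeg n x) (hc2.intervalIntegrable _ _) (hce'.intervalIntegrable _ _)
  have hparts2 := intervalIntegral.integral_deriv_mul_eq_sub (a := (0 : ℝ)) (b := 1)
    (u := G0) (v := eNeg n) (u' := G1) (v' := fun x => -(2 * π * I * n) * eNeg n x)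
    (fun x _ => hd0 x) (fun x _ => hasDerivAt_eNeg n x) (hc1.intervalIntegrable _ _) (hce'.intervalIntegrable _ _)
  rw [hb1, eNeg_one_right, eNeg_zero_right, sub_self] at hparts1
  rw [hb0, eNeg_one_right, eNeg_zero_right, sub_self] at hparts2
  have hi2e : IntervalIntegrable (fun x => G2 x * eNeg n x) volume 0 1 := (hc2.mul hce).intervalIntegrable _ _
  have hi1e' : IntervalIntegrable (fun x => G1 x * (-(2 * π * I * n) * eNeg n x)) volume 0 1 :=
    (hc1.mul hce').intervalIntegrable _ _
  have hi1e : IntervalIntegrable (fun x => G1 x * eNeg n x) volume 0 1 := (hc1.mul hce).intervalIntegrable _ _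
  have hi0e' : IntervalIntegrable (fun x => G0 x * (-(2 * π * I * n) * eNeg n x)) volume 0 1 :=
    (hc0.mul hce').intervalIntegrable _ _
  rw [intervalIntegral.integral_add hi2e hi1e'] at hparts1
  rw [intervalIntegral.integral_add hi1e hi0e'] at hparts2
  have e1 : (∫ x in (0 : ℝ)..1, G1 x * (-(2 * π * I * n) * eNeg n x)) =
      -(2 * π * I * n) * ∫ x in (0 : ℝ)..1, G1 x * eNeg n x := by
    rw [← intervalIntegral.integral_const_mul]
    exact intervalIntegral.integral_congr fun x _ => by ring
  have e2 : (∫ x in (0 : ℝ)..1, G0 x * (-(2 * π * I * n) * eNeg n x)) =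
      -(2 * π * I * n) * ∫ x in (0 : ℝ)..1, G0 x * eNeg n x := by
    rw [← intervalIntegral.integral_const_mul]
    exact intervalIntegral.integral_congr fun x _ => by ring
  rw [e1] at hparts1
  rw [e2] at hparts2
  have hI2 : I ^ 2 = -1 := Complex.I_sq
  have h1 : (∫ x in (0 : ℝ)..1, G2 x * eNeg n x) = (2 * π * I * n) * ∫ x in (0 : ℝ)..1, G1 x * eNeg n x := by
    linear_combination hparts1
  have h2 : (∫ x in (0 : ℝ)..1, G1 x * eNeg n x) = (2 * π * I * n) * ∫ x in (0 : ℝ)..1, G0 x * eNeg n x := by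
    linear_combination hparts2
  show (∫ x in (0 : ℝ)..1, G2 x * eNeg n x) = -(4 * π ^ 2 * n ^ 2) * ∫ x in (0 : ℝ)..1, G0 x * eNeg n x
  rw [h1, h2]
  linear_combination (4 * π ^ 2 * n ^ 2 * ∫ x in (0 : ℝ)..1, G0 x * eNeg n x) * hI2

/-- **The modes solve the rescaled Bessel equation**: with `μ` the eigenvalue
(`y² ΔF + μ F = 0`), `p_n = a_n'` has `p_n'(y) = ((2π|n|)² - μ/y²) a_n(y)`, i.e.
`y² a_n'' = (4π²n²y² - μ) a_n` — equation (1.25) for `F(2π|n|y)`.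
[cite: Iwaniec2002, (1.25), PDF p. 17] -/
theorem hasDerivAt_fourierMode_deriv_eq (hper : ∀ z : ℂ, 0 < z.im → F (z + 1) = F z) {μ : ℂ}
    (heig : ∀ z : ℂ, 0 < z.im → (z.im : ℂ) ^ 2 * Δ F z + μ * F z = 0) (n : ℤ) {y : ℝ} (hy : 0 < y) :
    HasDerivAt (fun t : ℝ => ∫ x in (0 : ℝ)..1, fderiv ℝ F ((x : ℂ) + (t : ℂ) * Complex.I) Complex.I * eNeg n x)
      ((((2 * π * |(n : ℝ)| : ℝ) : ℂ) ^ 2 - μ / (y : ℂ) ^ 2) * fourierMode F n y) y := by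
  have h := hasDerivAt_fourierMode_deriv hF n hy
  refine h.congr_deriv ?_
  have hy0 : (y : ℂ) ≠ 0 := Complex.ofReal_ne_zero.mpr hy.ne'
  -- pointwise: `y² F_II = -μ F - y² F_11`
  have hpt : ∀ x : ℝ,
      fderiv ℝ (fderiv ℝ F) ((x : ℂ) + (y : ℂ) * Complex.I) Complex.I Complex.I * eNeg n x =
      -(μ / (y : ℂ) ^ 2) * (F ((x : ℂ) + (y : ℂ) * Complex.I) * eNeg n x) -
        fderiv ℝ (fderiv ℝ F) ((x : ℂ) + (y : ℂ) * Complex.I) 1 1 * eNeg n x := by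
    intro x
    have h := heig ((x : ℂ) + (y : ℂ) * Complex.I) (im_pos_of_pt hy)
    rw [laplacian_eq_fderiv_fderiv] at h
    have him : (((x : ℂ) + (y : ℂ) * Complex.I).im : ℂ) = (y : ℂ) := by simp
    rw [him] at h
    field_simp
    linear_combination eNeg n x * h
  have hcF : Continuous fun x : ℝ => F ((x : ℂ) + (y : ℂ) * Complex.I) * eNeg n x :=
    (continuous_comp_horizontal hF.continuousOn hy).mul (continuous_eNeg n)
  have hc11 : Continuous fun x : ℝ => fderiv ℝ (fderiv ℝ F) ((x : ℂ) + (y : ℂ) * Complex.I) 1 1 * eNeg n x :=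
    (continuous_fderiv_fderiv_horizontal hF hy 1 1).mul (continuous_eNeg n)
  simp_rw [hpt]
  rw [intervalIntegral.integral_sub ((hcF.const_mul _).intervalIntegrable _ _) (hc11.intervalIntegrable _ _),
    intervalIntegral.integral_const_mul, integral_fderiv_fderiv_one_one_mul_eNeg hF hper n hy]
  rw [← fourierMode]
  have habs : (((2 * π * |(n : ℝ)| : ℝ) : ℂ)) ^ 2 = 4 * π ^ 2 * n ^ 2 := by
    have hr : ((2 * π * |(n : ℝ)| : ℝ)) ^ 2 = 4 * π ^ 2 * (n : ℝ) ^ 2 := by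
      rw [mul_pow, mul_pow, sq_abs]; ring
    rw [← Complex.ofReal_pow, hr]
    push_cast; ring
  rw [habs]
  ring

omit hF in
/-- The mode is bounded by the sup of `F` on the horocycle: `‖a_n(y)‖ ≤ B` if `‖F(x+iy)‖ ≤ B` on
`[0, 1]`. [folklore] -/
theorem norm_fourierMode_le (n : ℤ) {y B : ℝ}
    (hB : ∀ x ∈ Icc (0 : ℝ) 1, ‖F ((x : ℂ) + (y : ℂ) * Complex.I)‖ ≤ B) : ‖fourierMode F n y‖ ≤ B := by
  have h := intervalIntegral.norm_integral_le_of_norm_le_const (a := (0 : ℝ)) (b := 1) (C := B)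
    (f := fun x => F ((x : ℂ) + (y : ℂ) * Complex.I) * eNeg n x) fun x hx => by
      rw [uIoc_of_le zero_le_one] at hx
      rw [norm_mul, norm_eNeg, mul_one]
      exact hB x ⟨hx.1.le, hx.2⟩
  simpa [fourierMode] using h

end TwistedModes

/-! ## 5. Theorem 3.1: the non-zero modes are multiples of the Whittaker function -/

section TheoremThreeOne

open Laplacian

variable {F : ℂ → ℂ}

/-- **The Whittaker function is not identically zero** along any ray: for `r > 0` there is `y > 0`
with `W_s(i r y) ≠ 0`. [folklore] -/
theorem exists_whittakerW_ne_zero (s : ℂ) {r : ℝ} (hr : 0 < r) :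
    ∃ y : ℝ, 0 < y ∧ whittakerW s (r * y) ≠ 0 := by
  obtain ⟨y, hy, hne⟩ := exists_besselMode_ne_zero (-I * (s - 1 / 2)) (κ := 2 * π * r) (by positivity)
  refine ⟨y, hy, ?_⟩
  rw [whittakerW_eq_besselMode s hr hy]
  refine mul_ne_zero ?_ hne
  exact_mod_cast (Real.sqrt_pos.mpr hr).ne'

/-- **Iwaniec's Theorem 3.1, the non-zero modes.** Let `F` be `C²` and `1`-periodic on the upper
half-plane with `y² ΔF + s(1-s) F = 0`, and assume the growth condition (3.3),
`F(x + iy) = o(e^{2πy})` as `y → ∞` uniformly in `x ∈ [0, 1]`. Then for every `n ≠ 0` the `n`-th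
Fourier mode is a constant multiple of the Whittaker function:
`∫₀¹ F(x+iy) e(-nx) dx = c_n · 2√(|n|y) K_{s-1/2}(2π|n|y)` for all `y > 0` — i.e.
`F(z) = a₀(y) + Σ_{n ≠ 0} c_n W_s(nz)` coefficientwise ((3.4); "this condition rules out the second
solution" `√y I_{s-1/2}`, p. 20). [cite: Iwaniec2002, Thm 3.1 (3.3)–(3.4) & (1.25)–(1.26), PDF pp. 17, 20, 41] -/
theorem fourierMode_eq_const_mul_whittakerW (hF : ContDiffOn ℝ 2 F {z : ℂ | 0 < z.im})
    (hper : ∀ z : ℂ, 0 < z.im → F (z + 1) = F z) {s : ℂ}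
    (heig : ∀ z : ℂ, 0 < z.im → (z.im : ℂ) ^ 2 * Δ F z + s * (1 - s) * F z = 0)
    (hgrowth : ∀ ε : ℝ, 0 < ε → ∃ Y : ℝ, ∀ y : ℝ, Y ≤ y →
      ∀ x ∈ Icc (0 : ℝ) 1, ‖F ((x : ℂ) + (y : ℂ) * Complex.I)‖ ≤ ε * Real.exp (2 * π * y))
    {n : ℤ} (hn : n ≠ 0) :
    ∃ c : ℂ, ∀ y : ℝ, 0 < y → fourierMode F n y = c * whittakerW s (|(n : ℝ)| * y) := by
  have hn' : 0 < |(n : ℝ)| := abs_pos.mpr (Int.cast_ne_zero.mpr hn)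
  have hn1 : 1 ≤ |(n : ℝ)| := by
    have : (1 : ℤ) ≤ |n| := Int.one_le_abs hn
    exact_mod_cast this
  set κ : ℝ := 2 * π * |(n : ℝ)| with hκ_def
  have hκ : 0 < κ := by positivity
  have hκ2π : 2 * π ≤ κ := by rw [hκ_def]; nlinarith [Real.pi_pos]
  set w : ℂ := -I * (s - 1 / 2) with hw
  set μ : ℂ := s * (1 - s) with hμ
  have hwμ : w ^ 2 + 1 / 4 = μ := neg_I_mul_sq_add_quarter s
  set q : ℝ → ℂ := fun y => (κ : ℂ) ^ 2 - μ / (y : ℂ) ^ 2 with hq_def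
  -- the decaying solution
  have hk : ∀ y, 0 < y → HasDerivAt (besselMode κ w) (besselMode₁ κ w y) y := fun y hy =>
    hasDerivAt_besselMode w hy hκ
  have hk₁ : ∀ y, 0 < y → HasDerivAt (besselMode₁ κ w) (q y * besselMode κ w y) y := by
    intro y hy
    have h := hasDerivAt_besselMode₁ w hy hκ
    rw [hwμ] at h
    exact h
  -- the mode and its derivative
  set p : ℝ → ℂ := fun t => ∫ x in (0 : ℝ)..1,
    fderiv ℝ F ((x : ℂ) + (t : ℂ) * Complex.I) Complex.I * eNeg n x with hp_def
  have hb : ∀ y, 0 < y → HasDerivAt (fourierMode F n) (p y) y := fun y hy => hasDerivAt_fourierMode hF n hy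
  have hp : ∀ y, 0 < y → HasDerivAt p (q y * fourierMode F n y) y := fun y hy =>
    hasDerivAt_fourierMode_deriv_eq hF hper heig n hy
  -- growth of the mode: `o(e^{κ y})`
  have hgr : ∀ ε : ℝ, 0 < ε → ∃ Y : ℝ, ∀ y : ℝ, Y ≤ y → ‖fourierMode F n y‖ ≤ ε * Real.exp (κ * y) := by
    intro ε hε
    obtain ⟨Y, hY⟩ := hgrowth ε hε
    refine ⟨max Y 0, fun y hy => ?_⟩
    have hy0 : 0 ≤ y := le_trans (le_max_right _ _) hy
    have h1 : ‖fourierMode F n y‖ ≤ ε * Real.exp (2 * π * y) :=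
      norm_fourierMode_le n (hY y (le_trans (le_max_left _ _) hy))
    refine h1.trans ?_
    gcongr
  obtain ⟨c, hc⟩ := exists_eq_const_mul_of_growth hκ μ (fun y _ => rfl) hk hk₁
    (fun y hy => norm_besselMode_le w hκ hy) (fun y hy => norm_besselMode₁_le w hκ hy)
    (exists_besselMode_ne_zero w hκ) hb hp hgr
  refine ⟨c / (Real.sqrt |(n : ℝ)| : ℂ), fun y hy => ?_⟩
  have hsq : (Real.sqrt |(n : ℝ)| : ℂ) ≠ 0 := by exact_mod_cast (Real.sqrt_pos.mpr hn').ne'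
  rw [hc y hy, whittakerW_eq_besselMode s hn' hy, ← hw, ← hκ_def]
  field_simp

/-- **Uniqueness of the coefficient**: if `a_n = c W_s(|n|·)` and `a_n = c' W_s(|n|·)` on `(0,∞)`
then `c = c'`. [folklore] -/
theorem whittaker_coeff_unique {s : ℂ} {n : ℤ} (hn : n ≠ 0) {a : ℝ → ℂ} {c c' : ℂ}
    (hc : ∀ y : ℝ, 0 < y → a y = c * whittakerW s (|(n : ℝ)| * y))
    (hc' : ∀ y : ℝ, 0 < y → a y = c' * whittakerW s (|(n : ℝ)| * y)) : c = c' := by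
  have hn' : 0 < |(n : ℝ)| := abs_pos.mpr (Int.cast_ne_zero.mpr hn)
  obtain ⟨y, hy, hne⟩ := exists_whittakerW_ne_zero s hn'
  have h := (hc y hy).symm.trans (hc' y hy)
  exact mul_right_cancel₀ hne h

end TheoremThreeOne

/-! ## 6. Automorphic forms: the Fourier coefficients at a cusp -/

namespace Fuchsian

section CuspCoefficients

open UpperHalfPlane Laplacian
open scoped MatrixGroups _root_.Pointwise

variable {Γ : Subgroup (GL (Fin 2) ℝ)}

/-- **The `n`-th Fourier mode of `v` at the cusp `𝔞 = σ∞`** along the horocycle through `w`: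
`∫₀¹ v(σ(w + ξ)) e(-nξ) dξ` (for `w = iy` this is `f_{𝔞n}(y)` of (3.2); `n = 0` is `cuspMeanAt`).
[cite: Iwaniec2002, §3.1 (3.2), PDF p. 41] -/
def cuspFourierModeAt (σ : SL(2, ℝ)) (v : ℍ → ℂ) (n : ℤ) (w : ℍ) : ℂ :=
  ∫ ξ in (0 : ℝ)..1, v (σ • (ξ +ᵥ w)) * eNeg n ξ

/-- The zero-th mode is the cusp mean. [folklore] -/
theorem cuspFourierModeAt_zero (σ : SL(2, ℝ)) (v : ℍ → ℂ) : cuspFourierModeAt σ v 0 = cuspMeanAt σ v := by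
  funext w
  simp [cuspFourierModeAt, cuspMeanAt_apply, eNeg]

/-- On the imaginary axis the cusp mode is the twisted mode of `v ∘ σ ∘ ofComplex`. [folklore] -/
theorem cuspFourierModeAt_eq_fourierMode (σ : SL(2, ℝ)) (v : ℍ → ℂ) (n : ℤ) {y : ℝ} (hy : 0 < y) :
    cuspFourierModeAt σ v n (ofComplex ⟨0, y⟩) =
      fourierMode ((fun z : ℍ => v (σ • z)) ∘ ofComplex) n y := by
  rw [cuspFourierModeAt, fourierMode]
  refine intervalIntegral.integral_congr fun x _ => ?_
  have hxy : 0 < ((x : ℂ) + (y : ℂ) * Complex.I).im := im_pos_of_pt hy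
  have h0 : ofComplex (⟨0, y⟩ : ℂ) = ⟨⟨0, y⟩, hy⟩ := ofComplex_apply_of_im_pos (z := (⟨0, y⟩ : ℂ)) hy
  simp only [Function.comp_apply, ofComplex_apply_of_im_pos hxy, h0]
  congr 3
  ext1
  rw [UpperHalfPlane.coe_vadd]
  apply Complex.ext <;> simp

/-- **Theorem 3.1 at a cusp of width one.** Let `σ⁻¹Γσ ∋ T₁`, `v` be `Γ`-automorphic and `C²`
with `(Δ + s(1-s))v = 0`, and `v(σz) = o(e^{2πy})` as `y = Im z → ∞` uniformly in `Re z` ((3.3)).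
Then for every `n ≠ 0` there is a constant `c` (the Fourier coefficient `ρ_𝔞(n)` up to
normalisation) with `∫₀¹ v(σ(x + iy)) e(-nx) dx = c · 2√(|n|y) K_{s-1/2}(2π|n|y)` for all `y > 0`.
[cite: Iwaniec2002, Thm 3.1 (3.2)–(3.4), PDF pp. 40–41] -/
theorem cuspFourierModeAt_eq_const_mul_whittakerW
    {v : ℍ → ℂ} (hva : IsAutomorphic Γ v) (hvc : IsC2 v) (σ : SL(2, ℝ))
    (hT : Matrix.GeneralLinearGroup.upperRightHom (1 : ℝ) ∈
      ConjAct.toConjAct (Matrix.SpecialLinearGroup.toGL σ : GL (Fin 2) ℝ)⁻¹ • Γ)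
    {s : ℂ} (heig : ∀ z, hypLaplacian v z + s * (1 - s) * v z = 0)
    (hgrowth : ∀ ε : ℝ, 0 < ε → ∃ Y : ℝ, ∀ z : ℍ, Y ≤ z.im → ‖v (σ • z)‖ ≤ ε * Real.exp (2 * π * z.im))
    {n : ℤ} (hn : n ≠ 0) :
    ∃ c : ℂ, ∀ y : ℝ, 0 < y →
      cuspFourierModeAt σ v n (ofComplex ⟨0, y⟩) = c * whittakerW s (|(n : ℝ)| * y) := by
  set S : GL (Fin 2) ℝ := Matrix.SpecialLinearGroup.toGL σ with hS
  set v' : ℍ → ℂ := fun z => v (σ • z) with hv'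
  have hdet : 0 < S.det.val := by simp [hS]
  have hv'c : IsC2 v' := hvc.comp_smul hdet
  have hv'a : IsAutomorphic (ConjAct.toConjAct S⁻¹ • Γ) v' := by
    intro γ' hγ' z
    have hδ : S * γ' * S⁻¹ ∈ Γ := (Fuchsian.mem_conj_inv_iff S γ').mp hγ'
    simp only [hv']
    have e : σ • γ' • z = (S * γ' * S⁻¹) • (σ • z) := by
      rw [← toGL_smul_eq, ← toGL_smul_eq, mul_smul, mul_smul, inv_smul_smul]
    rw [e, hva _ hδ]
  have hv'e : ∀ z, hypLaplacian v' z + s * (1 - s) * v' z = 0 := by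
    intro z
    simp only [hv']
    rw [show (fun z => v (σ • z)) = fun z => v (S • z) from rfl,
      hypLaplacian_comp_smul hdet v z (hvc.contDiffAt
        (UpperHalfPlane.isOpen_upperHalfPlaneSet.mem_nhds (S • z).im_pos))]
    exact heig _
  set F : ℂ → ℂ := v' ∘ ofComplex with hF_def
  have hgr : ∀ ε : ℝ, 0 < ε → ∃ Y : ℝ, ∀ y : ℝ, Y ≤ y →
      ∀ x ∈ Icc (0 : ℝ) 1, ‖F ((x : ℂ) + (y : ℂ) * Complex.I)‖ ≤ ε * Real.exp (2 * π * y) := by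
    intro ε hε
    obtain ⟨Y, hY⟩ := hgrowth ε hε
    refine ⟨max Y 1, fun y hy x _ => ?_⟩
    have hy0 : 0 < y := lt_of_lt_of_le one_pos (le_trans (le_max_right _ _) hy)
    have hxy : 0 < ((x : ℂ) + (y : ℂ) * Complex.I).im := im_pos_of_pt hy0
    simp only [hF_def, hv', Function.comp_apply, ofComplex_apply_of_im_pos hxy]
    have him : (⟨(x : ℂ) + (y : ℂ) * Complex.I, hxy⟩ : ℍ).im = y := by
      show ((x : ℂ) + (y : ℂ) * Complex.I).im = y
      simp
    have h := hY ⟨(x : ℂ) + (y : ℂ) * Complex.I, hxy⟩ (by rw [him]; exact le_trans (le_max_left _ _) hy)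
    rw [him] at h
    exact h
  obtain ⟨c, hc⟩ := fourierMode_eq_const_mul_whittakerW hv'c (periodic_of_upperRightHom_mem hv'a hT)
    (eigen_ofComplex_complex hv'e) hgr hn
  exact ⟨c, fun y hy => by rw [cuspFourierModeAt_eq_fourierMode σ v n hy]; exact hc y hy⟩

/-- **The Fourier coefficient `ρ_𝔞(n)` of `v` at the cusp `σ∞`** (spectral parameter `s`): the
constant `c` with `∫₀¹ v(σ(x+iy)) e(-nx) dx = c · W_s(i|n|y)` for all `y > 0` (Theorem 3.1), and `0`
if there is no such constant (e.g. for `n = 0`, or when `v` is not an eigenfunction).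
[cite: Iwaniec2002, Thm 3.1 (3.4), PDF p. 41] -/
def cuspFourierCoeff (σ : SL(2, ℝ)) (v : ℍ → ℂ) (s : ℂ) (n : ℤ) : ℂ :=
  open scoped Classical in
  if h : ∃ c : ℂ, ∀ y : ℝ, 0 < y →
      cuspFourierModeAt σ v n (ofComplex ⟨0, y⟩) = c * whittakerW s (|(n : ℝ)| * y)
  then h.choose else 0

/-- The defining identity of the Fourier coefficient, whenever some constant works (`n ≠ 0`).
[cite: Iwaniec2002, Thm 3.1 (3.4), PDF p. 41] -/
theorem cuspFourierModeAt_eq_coeff_mul (σ : SL(2, ℝ)) (v : ℍ → ℂ) (s : ℂ) {n : ℤ}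
    (h : ∃ c : ℂ, ∀ y : ℝ, 0 < y →
      cuspFourierModeAt σ v n (ofComplex ⟨0, y⟩) = c * whittakerW s (|(n : ℝ)| * y))
    {y : ℝ} (hy : 0 < y) :
    cuspFourierModeAt σ v n (ofComplex ⟨0, y⟩) = cuspFourierCoeff σ v s n * whittakerW s (|(n : ℝ)| * y) := by
  classical
  rw [cuspFourierCoeff, dif_pos h]
  exact h.choose_spec y hy

/-- The coefficient is the unique constant in Theorem 3.1 (`n ≠ 0`). [folklore] -/
theorem cuspFourierCoeff_eq_of_forall (σ : SL(2, ℝ)) (v : ℍ → ℂ) (s : ℂ) {n : ℤ} (hn : n ≠ 0) {c : ℂ}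
    (hc : ∀ y : ℝ, 0 < y →
      cuspFourierModeAt σ v n (ofComplex ⟨0, y⟩) = c * whittakerW s (|(n : ℝ)| * y)) :
    cuspFourierCoeff σ v s n = c :=
  whittaker_coeff_unique hn (fun _ hy => cuspFourierModeAt_eq_coeff_mul σ v s ⟨c, hc⟩ hy) hc

/-- **Theorem 3.1 with the named coefficient**: under the hypotheses of
`cuspFourierModeAt_eq_const_mul_whittakerW`,
`∫₀¹ v(σ(x+iy)) e(-nx) dx = ρ(n) · 2√(|n|y) K_{s-1/2}(2π|n|y)` with `ρ(n) = cuspFourierCoeff σ v s n`.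
[cite: Iwaniec2002, Thm 3.1 (3.4), PDF p. 41] -/
theorem cuspFourierModeAt_eq_cuspFourierCoeff_mul_whittakerW
    {v : ℍ → ℂ} (hva : IsAutomorphic Γ v) (hvc : IsC2 v) (σ : SL(2, ℝ))
    (hT : Matrix.GeneralLinearGroup.upperRightHom (1 : ℝ) ∈
      ConjAct.toConjAct (Matrix.SpecialLinearGroup.toGL σ : GL (Fin 2) ℝ)⁻¹ • Γ)
    {s : ℂ} (heig : ∀ z, hypLaplacian v z + s * (1 - s) * v z = 0)
    (hgrowth : ∀ ε : ℝ, 0 < ε → ∃ Y : ℝ, ∀ z : ℍ, Y ≤ z.im → ‖v (σ • z)‖ ≤ ε * Real.exp (2 * π * z.im))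
    {n : ℤ} (hn : n ≠ 0) {y : ℝ} (hy : 0 < y) :
    cuspFourierModeAt σ v n (ofComplex ⟨0, y⟩) =
      cuspFourierCoeff σ v s n * whittakerW s (|(n : ℝ)| * y) :=
  cuspFourierModeAt_eq_coeff_mul σ v s
    (cuspFourierModeAt_eq_const_mul_whittakerW hva hvc σ hT heig hgrowth hn) hy

end CuspCoefficients

end Fuchsian


end Literature.NumberTheory.Automorphic
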